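import Literature.AlgebraicGeometry.Motives.SmoothSpread
import Mathlib.AlgebraicGeometry.Morphisms.SmoothFiber
import Mathlib.AlgebraicGeometry.Morphisms.UniversallyClosed
import Mathlib.AlgebraicGeometry.FunctionField
import HarnessLib

/-!
# A morphism with smooth generic fibre is smooth over a non-empty open of the base

Topic: `Literature/AlgebraicGeometry/Morphisms`. Let `Y` be an integral scheme with generic
point `η` and `f : X → Y` locally of finite presentation.

* `flat_fromSpecResidueField_genericPoint` — `Spec κ(η) → Y` is flat: every stalk map out of
  `𝒪_{Y,η}`, a field (the function field), is flat.
* `mem_smoothLocus_of_apply_eq_genericPoint` — **if the generic fibre `X_η → Spec κ(η)` is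
  smooth, every point of `X` over `η` lies in the smooth locus `sm(X/Y)` of `f`** (EGA IV₄
  17.8.2 / Stacks 01V9: for `f` flat at `x` — automatic over the generic point — `f` is smooth
  at `x` iff the fibre is smooth at `x`). The proof feeds the cartesian square of the generic
  fibre to `Literature.AlgebraicGeometry.Motives.mem_smoothLocus_of_isPullback` (base change
  along a flat morphism surjective on stalks does not change the stalk maps up to isomorphism).
* `exists_smooth_morphismRestrict_of_smooth_fiber_genericPoint` — **generic smoothness from the
  generic fibre**: if moreover `f` is a closed map (e.g. proper), there is an open `V ∋ η` of
  `Y` with `f⁻¹(V) → V` smooth, namely `V = Y ∖ f(X ∖ sm(X/Y))` (EGA IV₄ 17.7.8-style spreading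
  out in its elementary pointwise form; cf. de Jong 1996, 4.17, where "(vi) c) the generic fibre
  of `f` is smooth" yields the non-empty open `U = {y ∈ Y | X_y is smooth over y …}`).
* `exists_smooth_morphismRestrict_le_of_smooth_fiber_genericPoint` — the same inside any given
  non-empty open `U` of `Y`.

## References

* A. Grothendieck, EGA IV₄ (1967), 17.7.8, 17.8.2.
* The Stacks project, Tag 01V9 (smoothness and flatness with smooth fibres).
* A. J. de Jong, *Smoothness, semi-stability and alterations*, Publ. Math. IHÉS 83 (1996), 4.17,
  p. 71.
-/

noncomputable section

open CategoryTheory CategoryTheory.Limits AlgebraicGeometry TopologicalSpace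

namespace Literature.AlgebraicGeometry.Morphisms

universe u

variable {X Y : Scheme.{u}}

/-- For an integral scheme `Y` with generic point `η`, the morphism `Spec κ(η) → Y` is flat:
its stalk maps are ring maps out of `𝒪_{Y,η} = K(Y)`, a field, and every module over a field
is flat. [folklore] -/
theorem flat_fromSpecResidueField_genericPoint (Y : Scheme.{u}) [IsIntegral Y] :
    Flat (Y.fromSpecResidueField (genericPoint Y)) := by
  refine Flat.of_stalkMap _ fun s => ?_
  have hfield : IsField (Y.presheaf.stalk (Y.fromSpecResidueField (genericPoint Y) s)) := by
    rw [Scheme.fromSpecResidueField_apply]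
    exact Field.toIsField Y.functionField
  exact RingHom.Flat.of_isField hfield _

/-- **Smooth generic fibre ⇒ smooth at every point over the generic point.** Let `Y` be integral
with generic point `η`, `f : X → Y` locally of finite presentation with smooth generic fibre
`X_η → Spec κ(η)`. Then every `x ∈ X` with `f x = η` lies in the smooth locus of `f` (Mathlib's
`Scheme.Hom.smoothLocus`: the stalk map `𝒪_{Y,η} → 𝒪_{X,x}` is formally smooth). Indeed the
generic fibre is the base change of `f` along `Spec κ(η) → Y`, which is flat and surjective on
stalks, so the stalk map of `f` at `x` is isomorphic to that of `X_η → Spec κ(η)` at the point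
over `x` (`Literature.AlgebraicGeometry.Motives.mem_smoothLocus_of_isPullback`).
[cite: StacksProject, Tag 01V9] -/
theorem mem_smoothLocus_of_apply_eq_genericPoint [IsIntegral Y] (f : X ⟶ Y)
    [LocallyOfFinitePresentation f]
    (hsm : Smooth (f.fiberToSpecResidueField (genericPoint Y))) {x : X}
    (hx : f x = genericPoint Y) : x ∈ f.smoothLocus := by
  haveI := flat_fromSpecResidueField_genericPoint Y
  haveI := hsm
  have H : IsPullback (f.fiberι (genericPoint Y)) (f.fiberToSpecResidueField (genericPoint Y)) f
      (Y.fromSpecResidueField (genericPoint Y)) :=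
    IsPullback.of_hasPullback _ _
  obtain ⟨x', rfl⟩ : x ∈ Set.range (f.fiberι (genericPoint Y)) := by
    rw [Scheme.Hom.range_fiberι]
    exact hx
  refine Literature.AlgebraicGeometry.Motives.mem_smoothLocus_of_isPullback H ?_
  rw [Scheme.Hom.smoothLocus_eq_top]
  trivial

/-- The smooth locus of a restriction `f|_V : f⁻¹(V) → V` over an open `V` of the base consists
of the points of `f⁻¹(V)` lying in the smooth locus of `f` (the stalk maps agree up to
isomorphism, Mathlib `morphismRestrictStalkMap`). [folklore] -/
theorem mem_smoothLocus_morphismRestrict_iff (f : X ⟶ Y) [LocallyOfFinitePresentation f]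
    (V : Y.Opens) (x : ((f ⁻¹ᵁ V : X.Opens) : Scheme.{u})) :
    x ∈ (f ∣_ V).smoothLocus ↔ x.1 ∈ f.smoothLocus := by
  rw [Scheme.Hom.mem_smoothLocus, Scheme.Hom.mem_smoothLocus]
  exact RingHom.FormallySmooth.respectsIso.arrow_mk_iso_iff (morphismRestrictStalkMap f V x)

/-- If `f⁻¹(V)` is contained in the smooth locus of `f`, then `f|_V : f⁻¹(V) → V` is smooth.
[folklore] -/
theorem smooth_morphismRestrict_of_preimage_le_smoothLocus (f : X ⟶ Y)
    [LocallyOfFinitePresentation f] (V : Y.Opens) (hV : f ⁻¹ᵁ V ≤ f.smoothLocus) :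
    Smooth (f ∣_ V) := by
  rw [← Scheme.Hom.smoothLocus_eq_top_iff, ← top_le_iff]
  intro x _
  exact (mem_smoothLocus_morphismRestrict_iff f V x).mpr (hV x.2)

/-- **Generic smoothness from a smooth generic fibre.** Let `Y` be integral with generic point
`η`, and `f : X → Y` locally of finite presentation and universally closed (e.g. proper) with
smooth generic fibre. Then `f` is smooth over an open neighbourhood `V` of `η`, i.e.
`f⁻¹(V) → V` is smooth: take `V = Y ∖ f(X ∖ sm(X/Y))`, open since `f` is closed, containing `η`
since the whole fibre over `η` is in the smooth locus
(`mem_smoothLocus_of_apply_eq_genericPoint`). [cite: StacksProject, Tag 01V9] -/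
theorem exists_smooth_morphismRestrict_of_smooth_fiber_genericPoint [IsIntegral Y] (f : X ⟶ Y)
    [LocallyOfFinitePresentation f] [UniversallyClosed f]
    (hsm : Smooth (f.fiberToSpecResidueField (genericPoint Y))) :
    ∃ V : Y.Opens, genericPoint Y ∈ V ∧ Smooth (f ∣_ V) := by
  have hcl : IsClosed (f '' (f.smoothLocus : Set X)ᶜ) :=
    f.isClosedMap _ f.smoothLocus.isOpen.isClosed_compl
  refine ⟨⟨(f '' (f.smoothLocus : Set X)ᶜ)ᶜ, hcl.isOpen_compl⟩, ?_, ?_⟩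
  · rintro ⟨x, hx, hxη⟩
    exact hx (mem_smoothLocus_of_apply_eq_genericPoint f hsm hxη)
  · refine smooth_morphismRestrict_of_preimage_le_smoothLocus f _ fun x hx => ?_
    by_contra hxs
    exact hx ⟨x, hxs, rfl⟩

/-- **Generic smoothness inside a prescribed open.** In the situation of
`exists_smooth_morphismRestrict_of_smooth_fiber_genericPoint`, for every non-empty open `U` of
`Y` there is a non-empty open `W ⊆ U` over which `f` is smooth (`W = U ∩ V` contains `η`).
[folklore] -/
theorem exists_smooth_morphismRestrict_le_of_smooth_fiber_genericPoint [IsIntegral Y]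
    (f : X ⟶ Y) [LocallyOfFinitePresentation f] [UniversallyClosed f]
    (hsm : Smooth (f.fiberToSpecResidueField (genericPoint Y))) (U : Y.Opens)
    (hU : (U : Set Y).Nonempty) :
    ∃ W : Y.Opens, W ≤ U ∧ genericPoint Y ∈ W ∧ Smooth (f ∣_ W) := by
  obtain ⟨V, hηV, hV⟩ := exists_smooth_morphismRestrict_of_smooth_fiber_genericPoint f hsm
  haveI := hV
  have hηU : genericPoint Y ∈ U :=
    ((genericPoint_spec Y).mem_open_set_iff U.isOpen).mpr (by rwa [Set.univ_inter])
  -- `W = V ∩ U`, as the image under `V ↪ Y` of the preimage of `U`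
  refine ⟨V.ι ''ᵁ (V.ι ⁻¹ᵁ U), V.ι.image_preimage_le U, ?_, ?_⟩
  · refine ⟨⟨genericPoint Y, hηV⟩, ?_, rfl⟩
    show (V.ι : V → Y) ⟨genericPoint Y, hηV⟩ ∈ U
    exact hηU
  · exact (MorphismProperty.arrow_mk_iso_iff @Smooth (morphismRestrictRestrict f V (V.ι ⁻¹ᵁ U))).mp
      inferInstance

end Literature.AlgebraicGeometry.Morphisms

end
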